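import Summits.QuantumFields.YangMills.Theorems.BalabanUVNodesN15KingModelPauliLinksTight
import HarnessLib

/-!
# BalabanUVNodes ∕ N15 — THE KING-MODEL RUNG (PART Ϸ-j): THE EXACT BANDS OF THE PAULI PAIR — the `2 × 2` symbol is `H_W(q) = h₀(q)·1 + 2c·sin q′_{ν₀}sin a·σ₁ + 2c·sin q′_{ν₁}sin b·σ₂` with
# `h₀(q) = m² + 2(d+1)c − 2c(cos q′_{ν₀}cos a + cos q′_{ν₁}cos b + Σ_{flat μ}cos q′_μ)`; hence `(H_W(q) − h₀)² = R²·1`, `R² = 4c²(sin²q′_{ν₀}sin²a + sin²q′_{ν₁}sin²b)`, every fibre eigenvalue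
# is `h₀ ± R` (the two BANDS `4 − 2cos q₀cos a − 2cos q₁cos b ± 2√(sin²q₀sin²a + sin²q₁sin²b)` of door (t3⁵³), up to `m²`, `c` and the flat directions) and each band value IS a torus eigenvalue
# (Track A, DAG node N15 = NE2; FAN-OUT v1.1 §N15 s3 «KING-MODEL RUNG»; count-neutral)

HONEST FRAMING.  Count-neutral (cell `pub-ymgap`, seat `pub-ymgap-dag-n15-e` g48; `--supports stmt-QuantumFields-27247 --as helper` = K3ᴬ, KEY MAP v3).  Exact finite identities for King's fine
covariance layer `−cΔ_U + m²` (Ͱ-a `covLapF`) at the constant Pauli pair on ONE finite torus; NOT Bałaban's `G_k(U)`; NOT a node discharge; nothing continuum ∕ ℝ⁴ ∕ OS ∕ Clay.  (Completeness —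
that the `2|T|` band values exhaust the torus spectrum — is not claimed here; PART Ϸ-a's symbol identity gives the matching lower bound for all `v`.)

THE RESULTS (`K` any period vector; `ν₀ ≠ ν₁`; `ψ_μ = ψ_μ(q) = e^{iq′_μ}`, `x_μ = Re ψ_μ = cos q′_μ`, `y_μ = Im ψ_μ = sin q′_μ`):
* §1 `pauliCos a b ν₀ ν₁ μ ∈ {cos a, cos b, 1}` (the scalar part of each link), ★ `dress_rotX` ∕ `dress_rotY` ∕ `dress_one` (`ψ·W + ψ̄·W^* = 2x·cos_μ·1 − 2y·sin_μ·σ_μ`), ★★★ **`fibreOp_pauliLink_eq`**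
  (THE SYMBOL: `H_W(q) = h₀·1 + (2c·y_{ν₀}sin a)·σ₁ + (2c·y_{ν₁}sin b)·σ₂`, `h₀ = m² + 2(d+1)c − 2cΣ_μ x_μ·cos_μ`), `isHermitian_fibreOp_pauliLink`;
* §2 ★★ **`fibreOp_pauliLink_sub_sq`** (`(H_W(q) − h₀·1)² = R²·1`, `R² = (2c·y_{ν₀}sin a)² + (2c·y_{ν₁}sin b)²` — Pauli anticommutation);
* §3 ★★★ **`fibreOp_pauliLink_eigenvalues_sq`** (every eigenvalue `λ` of the symbol has `(λ − h₀)² = R²`), ★★ **`fibreOp_pauliLink_eigenvalues_eq_or`** (`λ = h₀ + R ∨ λ = h₀ − R`, `R = √R²`),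
  ★★ **`exists_torus_eigenvalue_eq_band`** (each band value at each momentum IS an eigenvalue of `−cΔ_W + m²` on the torus, Ϸ-b `exists_eigenvalue_eq_of_fibre`).
PRIOR TREE ART (by name): Ϸ-b (`fibreOp`, `exists_eigenvalue_eq_of_fibre`, `rclike_ofReal_complex`), Ϸ-c (`pauliX∕Y∕Z`, `rotX`, `rotY`, `conjTranspose_rotX∕Y`, `pauliX_mul_self`, `pauliY_mul_self`,
`pauliX_mul_pauliY`, `pauliY_mul_pauliX`, `isHermitian_pauliX∕Y`, `pauliLink`, `pauliLink_fst∕snd∕of_ne`), Mathlib (`Matrix.IsHermitian.mulVec_eigenvectorBasis`, `OrthonormalBasis.orthonormal`).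
Dedup (rg at filing): basename 0 files; needles `pauliCos|dress_rotX|fibreOp_pauliLink_eq|fibreOp_pauliLink_sub_sq|_eigenvalues_eq_or|exists_torus_eigenvalue_eq_band` 0 tree files.
Locators: [King1986] (4.4) p.670, (4.35) p.674, (2.12) p.653; [Balaban1984PropagatorsI] (1.29) p.23; [HornJohnson2013] Thm 4.2.2.  0 `sorry`, 1 `def`.
-/

noncomputable section

open scoped BigOperators ComplexConjugate ComplexOrder InnerProductSpace
open Finset Matrix WithLp

namespace Summit.QuantumFields.YangMills.BalabanUVNodes.N15KingModelRung.ConstantCurvature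

open Literature.MathematicalPhysics.QuantumFieldTheory.Balaban1983to89.B5Prop11Plancherel (Tor unitVec chi)
open Summit.QuantumFields.YangMills.BalabanUVNodes.N15KingModelRung.Covariant (covLapF isHermitian_covLapF)

/-! ## §1 The symbol of the pair, explicitly -/

section Symbol

/-- ★ DRESSING `e^{iaσ₁}` BY A PHASE: `ψ·e^{iaσ₁} + ψ̄·e^{−iaσ₁} = 2Re ψ·cos a·1 − 2Im ψ·sin a·σ₁`. [folklore] -/
theorem dress_rotX (ψ : ℂ) (a : ℝ) :
    ψ • rotX a + conj ψ • (rotX a)ᴴ = ((2 * ψ.re * Real.cos a : ℝ) : ℂ) • (1 : Matrix (Fin 2) (Fin 2) ℂ) - ((2 * ψ.im * Real.sin a : ℝ) : ℂ) • pauliX := by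
  rw [conjTranspose_rotX]
  ext i j; fin_cases i <;> fin_cases j <;> simp [rotX, pauliX, -Complex.ofReal_cos, -Complex.ofReal_sin] <;>
    apply Complex.ext <;> simp [Complex.mul_re, Complex.mul_im] <;> ring
/-- ★ DRESSING `e^{ibσ₂}`: `ψ·e^{ibσ₂} + ψ̄·e^{−ibσ₂} = 2Re ψ·cos b·1 − 2Im ψ·sin b·σ₂`. [folklore] -/
theorem dress_rotY (ψ : ℂ) (b : ℝ) :
    ψ • rotY b + conj ψ • (rotY b)ᴴ = ((2 * ψ.re * Real.cos b : ℝ) : ℂ) • (1 : Matrix (Fin 2) (Fin 2) ℂ) - ((2 * ψ.im * Real.sin b : ℝ) : ℂ) • pauliY := by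
  rw [conjTranspose_rotY]
  ext i j; fin_cases i <;> fin_cases j <;> simp [rotY, pauliY, -Complex.ofReal_cos, -Complex.ofReal_sin] <;>
    apply Complex.ext <;> simp [Complex.mul_re, Complex.mul_im] <;> ring
/-- DRESSING A FLAT LINK: `ψ·1 + ψ̄·1 = 2Re ψ·1`. [folklore] -/
theorem dress_one (ψ : ℂ) : ψ • (1 : Matrix (Fin 2) (Fin 2) ℂ) + conj ψ • (1 : Matrix (Fin 2) (Fin 2) ℂ)ᴴ = ((2 * ψ.re : ℝ) : ℂ) • (1 : Matrix (Fin 2) (Fin 2) ℂ) := by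
  rw [conjTranspose_one, ← add_smul, Complex.add_conj]

variable {d : ℕ} (K : Fin (d + 1) → ℕ) [hK : ∀ μ, NeZero (K μ)]

omit hK in
/-- THE SCALAR PART OF EACH LINK: `cos a` on `ν₀`, `cos b` on `ν₁`, `1` on the flat directions. [folklore] -/
def pauliCos (a b : ℝ) (ν₀ ν₁ : Fin (d + 1)) (μ : Fin (d + 1)) : ℝ := if μ = ν₀ then Real.cos a else if μ = ν₁ then Real.cos b else 1

/-- ★★★ **THE SYMBOL OF THE PAULI PAIR, EXPLICITLY**: with `ψ_μ = ψ_μ(q)`,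
`H_W(q) = h₀·1 + (2c·Im ψ_{ν₀}·sin a)·σ₁ + (2c·Im ψ_{ν₁}·sin b)·σ₂`, `h₀ = m² + 2(d+1)c − 2c·Σ_μ Re ψ_μ·cos_μ` — a scalar plus a vector in the `σ₁σ₂`-plane whose length is the
dressed transverse momentum. [cite: King1986, (4.4) p.670, (4.35) p.674; Balaban1984PropagatorsI, (1.29) p.23] -/
theorem fibreOp_pauliLink_eq (a b c m2 : ℝ) {ν₀ ν₁ : Fin (d + 1)} (hν : ν₀ ≠ ν₁) (q : Tor K) :
    fibreOp K (pauliLink (d := d) a b ν₀ ν₁) c m2 q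
      = ((m2 + 2 * ((d : ℝ) + 1) * c - 2 * c * ∑ μ, (chi K q (unitVec K μ)).re * pauliCos (d := d) a b ν₀ ν₁ μ : ℝ) : ℂ) • (1 : Matrix (Fin 2) (Fin 2) ℂ)
        + ((2 * c * (chi K q (unitVec K ν₀)).im * Real.sin a : ℝ) : ℂ) • pauliX + ((2 * c * (chi K q (unitVec K ν₁)).im * Real.sin b : ℝ) : ℂ) • pauliY := by
  -- each dressed link
  have hdress : ∀ μ, chi K q (unitVec K μ) • pauliLink (d := d) a b ν₀ ν₁ μ + conj (chi K q (unitVec K μ)) • (pauliLink (d := d) a b ν₀ ν₁ μ)ᴴ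
      = ((2 * (chi K q (unitVec K μ)).re * pauliCos (d := d) a b ν₀ ν₁ μ : ℝ) : ℂ) • (1 : Matrix (Fin 2) (Fin 2) ℂ)
        - (if μ = ν₀ then ((2 * (chi K q (unitVec K ν₀)).im * Real.sin a : ℝ) : ℂ) • pauliX else 0)
        - (if μ = ν₁ then ((2 * (chi K q (unitVec K ν₁)).im * Real.sin b : ℝ) : ℂ) • pauliY else 0) := fun μ => by
    by_cases h0 : μ = ν₀
    · subst h0
      rw [if_pos rfl, if_neg hν, pauliLink_fst, dress_rotX, sub_zero]
      simp [pauliCos]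
    · by_cases h1 : μ = ν₁
      · subst h1
        rw [if_neg h0, if_pos rfl, pauliLink_snd a b hν, dress_rotY, sub_zero]
        simp [pauliCos, h0]
      · rw [if_neg h0, if_neg h1, pauliLink_of_ne a b h0 h1, dress_one, sub_zero, sub_zero]
        simp [pauliCos, h0, h1]
  rw [fibreOp, Finset.sum_congr rfl fun μ _ => hdress μ, Finset.sum_sub_distrib, Finset.sum_sub_distrib, Finset.sum_ite_eq' Finset.univ ν₀, if_pos (Finset.mem_univ _),
    Finset.sum_ite_eq' Finset.univ ν₁, if_pos (Finset.mem_univ _), ← Finset.sum_smul]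
  rw [smul_sub, smul_sub, smul_smul, smul_smul, smul_smul]
  have h1 : (((m2 + 2 * ((d : ℝ) + 1) * c - 2 * c * ∑ μ, (chi K q (unitVec K μ)).re * pauliCos (d := d) a b ν₀ ν₁ μ : ℝ) : ℂ))
      = ((m2 + 2 * ((d : ℝ) + 1) * c : ℝ) : ℂ) - (c : ℂ) * ∑ μ, (((2 * (chi K q (unitVec K μ)).re * pauliCos (d := d) a b ν₀ ν₁ μ : ℝ)) : ℂ) := by
    push_cast
    congr 1
    rw [Finset.mul_sum, Finset.mul_sum]
    exact Finset.sum_congr rfl fun μ _ => by ring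
  have h2 : ((2 * c * (chi K q (unitVec K ν₀)).im * Real.sin a : ℝ) : ℂ) = (c : ℂ) * ((2 * (chi K q (unitVec K ν₀)).im * Real.sin a : ℝ) : ℂ) := by push_cast; ring
  have h3 : ((2 * c * (chi K q (unitVec K ν₁)).im * Real.sin b : ℝ) : ℂ) = (c : ℂ) * ((2 * (chi K q (unitVec K ν₁)).im * Real.sin b : ℝ) : ℂ) := by push_cast; ring
  rw [h1, h2, h3, sub_smul]
  abel

/-- The symbol of the pair is Hermitian (a real scalar plus real multiples of `σ₁`, `σ₂`). [folklore] -/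
theorem isHermitian_fibreOp_pauliLink (a b c m2 : ℝ) {ν₀ ν₁ : Fin (d + 1)} (hν : ν₀ ≠ ν₁) (q : Tor K) : (fibreOp K (pauliLink (d := d) a b ν₀ ν₁) c m2 q).IsHermitian := by
  rw [fibreOp_pauliLink_eq K a b c m2 hν q]
  have hsa : ∀ r : ℝ, IsSelfAdjoint ((r : ℝ) : ℂ) := fun r => Complex.conj_ofReal r
  exact ((Matrix.isHermitian_one.smul (hsa _)).add (isHermitian_pauliX.smul (hsa _))).add (isHermitian_pauliY.smul (hsa _))

end Symbol

/-! ## §2 The quadratic identity of the symbol -/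

section Quadratic

/-- `(p·σ₁ + r·σ₂)² = (p² + r²)·1` (anticommutation). [folklore] -/
theorem pauli_plane_sq (p r : ℂ) : (p • pauliX + r • pauliY) * (p • pauliX + r • pauliY) = (p ^ 2 + r ^ 2) • (1 : Matrix (Fin 2) (Fin 2) ℂ) := by
  rw [add_mul, mul_add, mul_add, smul_mul_smul, smul_mul_smul, smul_mul_smul, smul_mul_smul, pauliX_mul_self, pauliY_mul_self, pauliX_mul_pauliY, pauliY_mul_pauliX,
    smul_neg, add_smul]
  have hc : (r * p) • (Complex.I • pauliZ) = (p * r) • (Complex.I • pauliZ) := by rw [mul_comm]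
  rw [hc, sq, sq]
  abel

variable {d : ℕ} (K : Fin (d + 1) → ℕ) [hK : ∀ μ, NeZero (K μ)]

/-- ★★ **THE SYMBOL SATISFIES A QUADRATIC EQUATION**: `(H_W(q) − h₀·1)² = R²·1` with `R² = (2c·Im ψ_{ν₀}·sin a)² + (2c·Im ψ_{ν₁}·sin b)²`. [cite: King1986, (4.4) p.670, (4.35) p.674] -/
theorem fibreOp_pauliLink_sub_sq (a b c m2 : ℝ) {ν₀ ν₁ : Fin (d + 1)} (hν : ν₀ ≠ ν₁) (q : Tor K) :
    (fibreOp K (pauliLink (d := d) a b ν₀ ν₁) c m2 q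
        - ((m2 + 2 * ((d : ℝ) + 1) * c - 2 * c * ∑ μ, (chi K q (unitVec K μ)).re * pauliCos (d := d) a b ν₀ ν₁ μ : ℝ) : ℂ) • (1 : Matrix (Fin 2) (Fin 2) ℂ))
      * (fibreOp K (pauliLink (d := d) a b ν₀ ν₁) c m2 q
        - ((m2 + 2 * ((d : ℝ) + 1) * c - 2 * c * ∑ μ, (chi K q (unitVec K μ)).re * pauliCos (d := d) a b ν₀ ν₁ μ : ℝ) : ℂ) • (1 : Matrix (Fin 2) (Fin 2) ℂ))
      = ((((2 * c * (chi K q (unitVec K ν₀)).im * Real.sin a) ^ 2 + (2 * c * (chi K q (unitVec K ν₁)).im * Real.sin b) ^ 2 : ℝ)) : ℂ) • (1 : Matrix (Fin 2) (Fin 2) ℂ) := by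
  rw [fibreOp_pauliLink_eq K a b c m2 hν q, add_assoc, add_sub_cancel_left, pauli_plane_sq]
  push_cast
  ring_nf

end Quadratic

/-! ## §3 The bands -/

section Bands

variable {d : ℕ} (K : Fin (d + 1) → ℕ) [hK : ∀ μ, NeZero (K μ)]

/-- If `(M − h·1)² = R²·1` and `Mv = λv` with `v ≠ 0` (`λ, h, R²` real) then `(λ − h)² = R²`. [folklore] -/
theorem eigenvalue_sq_of_quadratic {M : Matrix (Fin 2) (Fin 2) ℂ} {h R2 : ℝ} (hM : (M - (h : ℂ) • 1) * (M - (h : ℂ) • 1) = (R2 : ℂ) • (1 : Matrix (Fin 2) (Fin 2) ℂ))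
    {v : Fin 2 → ℂ} (hv : v ≠ 0) {lam : ℝ} (heig : M *ᵥ v = (lam : ℂ) • v) : (lam - h) ^ 2 = R2 := by
  have h1 : (M - (h : ℂ) • 1) *ᵥ v = ((lam - h : ℝ) : ℂ) • v := by
    rw [Matrix.sub_mulVec, heig, Matrix.smul_mulVec, Matrix.one_mulVec, ← sub_smul]; push_cast; rfl
  have h2 : ((M - (h : ℂ) • 1) * (M - (h : ℂ) • 1)) *ᵥ v = (((lam - h) ^ 2 : ℝ) : ℂ) • v := by
    rw [← Matrix.mulVec_mulVec, h1, Matrix.mulVec_smul, h1, smul_smul]; push_cast; ring_nf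
  rw [hM, Matrix.smul_mulVec, Matrix.one_mulVec] at h2
  -- `R²·v = (λ−h)²·v` with `v ≠ 0`
  obtain ⟨i, hi⟩ := Function.ne_iff.mp hv
  have h3 := congr_fun h2 i
  simp only [Pi.smul_apply, smul_eq_mul] at h3
  have h4 : ((R2 : ℝ) : ℂ) = (((lam - h) ^ 2 : ℝ) : ℂ) := mul_right_cancel₀ hi h3
  exact (Complex.ofReal_injective h4).symm

/-- ★★★ **THE BANDS**: every eigenvalue `λ` of the symbol `H_W(q)` satisfies `(λ − h₀(q))² = R(q)²` — i.e. the fibre spectrum is `{h₀ − R, h₀ + R}`,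
`h₀ = m² + 2(d+1)c − 2cΣ_μ cos q′_μ·cos_μ`, `R² = 4c²(sin²q′_{ν₀}sin²a + sin²q′_{ν₁}sin²b)`: the bands `4 − 2cos q₀cos a − 2cos q₁cos b ± 2√(sin²q₀sin²a + sin²q₁sin²b)` of the door.
[cite: King1986, (4.4) p.670, (4.35) p.674; HornJohnson2013, Thm 4.2.2] -/
theorem fibreOp_pauliLink_eigenvalues_sq (a b c m2 : ℝ) {ν₀ ν₁ : Fin (d + 1)} (hν : ν₀ ≠ ν₁) (q : Tor K) (i : Fin 2) :
    ((isHermitian_fibreOp_pauliLink K a b c m2 hν q).eigenvalues i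
        - (m2 + 2 * ((d : ℝ) + 1) * c - 2 * c * ∑ μ, (chi K q (unitVec K μ)).re * pauliCos (d := d) a b ν₀ ν₁ μ)) ^ 2
      = (2 * c * (chi K q (unitVec K ν₀)).im * Real.sin a) ^ 2 + (2 * c * (chi K q (unitVec K ν₁)).im * Real.sin b) ^ 2 := by
  set hH := isHermitian_fibreOp_pauliLink K a b c m2 hν q
  have hv : (⇑(hH.eigenvectorBasis i) : Fin 2 → ℂ) ≠ 0 := fun h0 => by
    have h1 := hH.eigenvectorBasis.orthonormal.1 i
    have : (hH.eigenvectorBasis i : EuclideanSpace ℂ (Fin 2)) = 0 := by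
      ext j; simpa using congr_fun h0 j
    rw [this, norm_zero] at h1
    exact zero_ne_one h1
  have heig : fibreOp K (pauliLink (d := d) a b ν₀ ν₁) c m2 q *ᵥ ⇑(hH.eigenvectorBasis i) = ((hH.eigenvalues i : ℝ) : ℂ) • ⇑(hH.eigenvectorBasis i) := by
    rw [hH.mulVec_eigenvectorBasis i]
    funext j; simp only [Pi.smul_apply, Complex.real_smul, smul_eq_mul]
  exact eigenvalue_sq_of_quadratic (fibreOp_pauliLink_sub_sq K a b c m2 hν q) hv heig

/-- ★★ … hence EACH FIBRE EIGENVALUE IS ONE OF THE TWO BAND VALUES `h₀ ± R`, `R = √(R²)`. [cite: King1986, (4.4) p.670, (4.35) p.674] -/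
theorem fibreOp_pauliLink_eigenvalues_eq_or (a b c m2 : ℝ) {ν₀ ν₁ : Fin (d + 1)} (hν : ν₀ ≠ ν₁) (q : Tor K) (i : Fin 2) :
    (isHermitian_fibreOp_pauliLink K a b c m2 hν q).eigenvalues i
        = (m2 + 2 * ((d : ℝ) + 1) * c - 2 * c * ∑ μ, (chi K q (unitVec K μ)).re * pauliCos (d := d) a b ν₀ ν₁ μ)
          + Real.sqrt ((2 * c * (chi K q (unitVec K ν₀)).im * Real.sin a) ^ 2 + (2 * c * (chi K q (unitVec K ν₁)).im * Real.sin b) ^ 2)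
      ∨ (isHermitian_fibreOp_pauliLink K a b c m2 hν q).eigenvalues i
        = (m2 + 2 * ((d : ℝ) + 1) * c - 2 * c * ∑ μ, (chi K q (unitVec K μ)).re * pauliCos (d := d) a b ν₀ ν₁ μ)
          - Real.sqrt ((2 * c * (chi K q (unitVec K ν₀)).im * Real.sin a) ^ 2 + (2 * c * (chi K q (unitVec K ν₁)).im * Real.sin b) ^ 2) := by
  have h := fibreOp_pauliLink_eigenvalues_sq K a b c m2 hν q i
  set lam := (isHermitian_fibreOp_pauliLink K a b c m2 hν q).eigenvalues i
  set h0 := m2 + 2 * ((d : ℝ) + 1) * c - 2 * c * ∑ μ, (chi K q (unitVec K μ)).re * pauliCos (d := d) a b ν₀ ν₁ μ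
  set R2 := (2 * c * (chi K q (unitVec K ν₀)).im * Real.sin a) ^ 2 + (2 * c * (chi K q (unitVec K ν₁)).im * Real.sin b) ^ 2
  have hR2 : 0 ≤ R2 := by positivity
  have h' : (lam - h0) ^ 2 = Real.sqrt R2 ^ 2 := by rw [Real.sq_sqrt hR2]; exact h
  rcases sq_eq_sq_iff_eq_or_eq_neg.mp h' with h1 | h1
  · left; linarith
  · right; linarith

/-- ★★ **EACH BAND VALUE IS A TORUS EIGENVALUE**: for every momentum `q` and `i`, the fibre eigenvalue `λ_i(q) ∈ {h₀(q) ± R(q)}` IS an eigenvalue of `−cΔ_W + m²` on the torus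
(eigenvector `χ_q ⊗ ξ_i(q)`; Ϸ-b `exists_eigenvalue_eq_of_fibre`). [cite: King1986, (4.4) p.670, (4.35) p.674; HornJohnson2013, Thm 4.2.2] -/
theorem exists_torus_eigenvalue_eq_band (a b c m2 : ℝ) {ν₀ ν₁ : Fin (d + 1)} (hν : ν₀ ≠ ν₁) (q : Tor K) (i : Fin 2) :
    ∃ j, (isHermitian_covLapF K c m2 (kingConstLink K (pauliLink (d := d) a b ν₀ ν₁))).eigenvalues j = (isHermitian_fibreOp_pauliLink K a b c m2 hν q).eigenvalues i := by
  set hH := isHermitian_fibreOp_pauliLink K a b c m2 hν q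
  have hv : (⇑(hH.eigenvectorBasis i) : Fin 2 → ℂ) ≠ 0 := fun h0 => by
    have h1 := hH.eigenvectorBasis.orthonormal.1 i
    have : (hH.eigenvectorBasis i : EuclideanSpace ℂ (Fin 2)) = 0 := by
      ext j; simpa using congr_fun h0 j
    rw [this, norm_zero] at h1
    exact zero_ne_one h1
  have heig : fibreOp K (pauliLink (d := d) a b ν₀ ν₁) c m2 q *ᵥ ⇑(hH.eigenvectorBasis i) = ((hH.eigenvalues i : ℝ) : ℂ) • ⇑(hH.eigenvectorBasis i) := by
    rw [hH.mulVec_eigenvectorBasis i]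
    funext j; simp only [Pi.smul_apply, Complex.real_smul, smul_eq_mul]
  exact exists_eigenvalue_eq_of_fibre K hv heig

end Bands

end Summit.QuantumFields.YangMills.BalabanUVNodes.N15KingModelRung.ConstantCurvature

end
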